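import Summits.QuantumFields.BalabanUV.T4Continuum.Support.ShellMeasureInterpAnalytic
import Summits.QuantumFields.BalabanUV.T4Continuum.Support.ShellMeasureWilsonMoving
import Summits.QuantumFields.BalabanUV.T4Continuum.Support.ShellMeasureScalingLocal

/-!
# `T4Continuum.ShellMeasureLevelAssembly` — (M1) AT ANY LEVEL from PLAQUETTE-ANALYTIC classifier data, GRADED sectioned
# weight words and a non-Wilson ray bound: the one-depth assembly with every analytic input a binder of printed TYPE
# (cell `pub-balaban`, sub-cell `t4`, spine estimate NE7c (node U5b); lineage t4-ne7c-p1 = PROVER seat P1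
# «shell-measure route», generation 25; ADDITIVE — imports `ShellMeasureInterpAnalytic` (p205468),
# `ShellMeasureWilsonMoving`, `ShellMeasureScalingLocal` (the engine, p200140) only)

HONEST FRAMING.  Finite four-torus programme, rung (B)+1 only — NOT infinite volume, NOT a mass gap, NOT the Clay
problem, NOT summit progress; (B), `BetaPertHyp`, (B^μ) not consumed.  The cell wall of NE7c — (M1) FOR BAŁABAN'S
INDUCTIVELY DEFINED EFFECTIVE MEASURES — is NOT PRINTED (GAPS G-ne7cp1-1), asserted by nobody, and NOT moved: THIS
THEOREM IS CONDITIONAL — its analytic hypotheses are, at a live level `j ≥ 1`, the located inputs (AN-bound)_j (B11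
Prop. 9 TYPE: analyticity–boundedness of the localized minimiser's plaquette ∕ bond variables along the complexified
block contraction, uniform in `k` — GAPS G-ne7cp1-8a ∕ -14, NOT displayed as numbers), the sizes ∕ Lipschitz data of the
sectioned words, and a ray bound for the non-Wilson terms `𝐄_j ∕ 𝐑_j ∕ 𝐁_j` of `A_j` (B12 Thm 1 TYPE, Cauchy form of
`ShellMeasureHeadlines` §2) — NONE instantiated here.  What is kernel: the composition.  0 sorry, 0 citations.  HONEST
DEPENDENCY (cell): continuum YM on T⁴ ⇐ BetaPertH ∧ nine spine estimates (0/9 proved); BetaPertH ⇐ (D1) ∧ (D4) ∧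
CAP+tail; G-an2-4 gates asym, D1 and NE2/3/4.

THE POINT (`slotAntiConcentration_of_levelData`).  In a finite-dimensional real chart `E` (additive Haar `μ`) with a
centre-monotone factor `J` supported in a window `W`: CLASSIFIER `u(x) = max_{p∈P_u} ‖hol_p(x) − 1‖` whose plaquette
functionals along the contraction ray of every window point extend to complex-differentiable `f : ℂ → A`, `‖f‖ ≤ H`
on `‖w‖ < R` (`R > 1`), `f 0 = 0`, `f c = hol_p(c•x) − 1` on `[0,1]` — the binder (AN-bound); WEIGHT
`e^{−S}`, `S(x) = β Σ_{p∈P_w}(1 − τ(G_p(x))/N) + 𝓔(x)` with, at every window point, GRADED SECTIONED WORDS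
(`ShellMeasureWilsonMoving`: frozen contractions and moving `τ`-free unitary-type letters with sizes `t` and Lipschitz
constants `L` along the ray) evaluating to `G_p(c•x)`, sizes `≤ s̄_p ≤ 1`, `L ≤ L̄_p`, frozen deviation `≤ d̄_p`, and a
RAY BOUND `𝓔(c•x) ≤ 𝓔(x) + (1−c)·B_𝓔` on `c ∈ [1/2, 1]`; numbers `θ > 0`, `0 ≤ δ < 1`, `0 ≤ ρ ≤ (1−δ)/2`, `β ≥ 0`,
`N > 0` and the smallness (SM) `36·H/(R − 1)² ≤ δθ`.  CONCLUSION: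
`SlotAntiConcentration (μ.withDensity (J·e^{−S})) u θ ρ (2(dim E + B_f)/(1−δ))`,
`B_f = β Σ_p L̄_p(d̄_p + 4 s̄_p) + B_𝓔`.  At level 0 (`ShellMeasureWilsonBlock`) the words move linearly and
`L̄ = s̄`; at a live level the Lipschitz constants come from (AN-bound) by
`ShellMeasureWilsonMoving.movingData_of_differentiableOn_ball` (`L = 3a·x₀/(R − x₀)`), the plaquette pairs `(R, H)`
from bond pairs by the lineage's `T4ShellMeasurePlaquette`.  So, for the one-depth engine, the smooth member's ENTIRE
analytic input at a live level is: (AN-bound)_j + (SM)_j + the non-Wilson ray bound — no transversal proxy, no onset,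
no fibre alternative (the (γ″) chain of `T4ShellMeasureAnalytic` §5 is superseded for this purpose).

WHAT THIS DOES NOT DO.  No instance of any binder at `j ≥ 1`; (LR) (window insertion), (MR) (dropped straddling
co-tests), (W1), the (F∞)-rate keep their status; NE7c NOT proved; 0/9 spine.
-/

noncomputable section

open NormedSpace Set Metric MeasureTheory

namespace Summit.QuantumFields.BalabanUV.T4Continuum.ShellMeasureLevelAssembly

open scoped ENNReal
open Literature.MathematicalPhysics.QuantumFieldTheory.Balaban1983to89
open T4ShellMeasure (SlotAntiConcentration)
open ShellMeasureWilsonWords (depth_admissible)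
open ShellMeasureWilsonTrace (TraceData)
open ShellMeasureWilsonMoving (MLetter mwordEval mdFro sSum lSum abs_trace_sub_le_moving sSum_lSum_nonneg)
open ShellMeasureInterpAnalytic (coreMap_of_analytic_family)
open ShellMeasureScalingLocal (slotAntiConcentration_of_coreMap_mul)

variable {E : Type*} [NormedAddCommGroup E] [NormedSpace ℝ E] [MeasurableSpace E] [BorelSpace E]
  [FiniteDimensional ℝ E] (μ : Measure E) [μ.IsAddHaarMeasure]
variable {A : Type*} [NormedRing A] [NormedAlgebra ℂ A] [CompleteSpace A] [NormOneClass A]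

/-- the classifier `u(x) = max_{p ∈ P_u} ‖hol_p(x) − 1‖` from plaquette holonomy functions `hol p : E → A`.
[folklore] -/
def classifier {ι : Type*} {Pu : Finset ι} (hPu : Pu.Nonempty) (hol : ι → E → A) (x : E) : ℝ :=
  Pu.sup' hPu fun p => ‖hol p x - 1‖

/-- the sectioned action `S(x) = β Σ_{p ∈ P_w} (1 − τ(G_p(x))/N) + 𝓔(x)` (Wilson part over the plaquettes meeting the
block + the non-Wilson terms of the effective action, all read in the chart). [folklore] -/
def action (T : TraceData A) (β : ℝ) {κ : Type*} (Pw : Finset κ) (G : κ → E → A) (𝓔 : E → ℝ) (x : E) : ℝ :=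
  β * ∑ p ∈ Pw, (1 - T.τ (G p x) / T.N) + 𝓔 x

/-- the Boltzmann weight `e^{−S}`. [folklore] -/
def weight (T : TraceData A) (β : ℝ) {κ : Type*} (Pw : Finset κ) (G : κ → E → A) (𝓔 : E → ℝ) (x : E) : ℝ≥0∞ :=
  ENNReal.ofReal (Real.exp (-action T β Pw G 𝓔 x))

omit [NormedSpace ℝ E] [MeasurableSpace E] [BorelSpace E] [FiniteDimensional ℝ E] [NormedAlgebra ℂ A]
  [CompleteSpace A] [NormOneClass A] in
/-- the classifier is continuous when the holonomies are. [folklore] -/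
theorem continuous_classifier {ι : Type*} {Pu : Finset ι} (hPu : Pu.Nonempty) {hol : ι → E → A}
    (hcont : ∀ p ∈ Pu, Continuous (hol p)) : Continuous (classifier hPu hol) :=
  Continuous.finset_sup'_apply hPu fun p hp => continuous_norm.comp ((hcont p hp).sub continuous_const)

/-- (S-ii) at any level, packaged: the WILSON PART of the sectioned action along the contraction, from graded sectioned
words — `Σ_p (1 − τ(G_p(c•x))/N) − Σ_p (1 − τ(G_p(x))/N) ≤ (1−c)·Σ_p L̄_p(d̄_p + 4 s̄_p)` (times `β ≥ 0`). [folklore] -/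
theorem wilsonPart_contract_sub_le (T : TraceData A) (hN : 0 < T.N) {κ : Type*} (Pw : Finset κ)
    (Gc G1 : κ → A) (gw : κ → List (MLetter A × ℝ × ℝ))
    (hgood : ∀ p ∈ Pw, ∀ y ∈ gw p, y.1.Good T.τ y.2.1 y.2.2) {sw lw dw : κ → ℝ}
    (hsw : ∀ p ∈ Pw, sSum (gw p) ≤ sw p) (hsw1 : ∀ p ∈ Pw, sw p ≤ 1) (hlw : ∀ p ∈ Pw, lSum (gw p) ≤ lw p)
    (hdw : ∀ p ∈ Pw, mdFro ((gw p).map Prod.fst) ≤ dw p) {c : ℝ} (hc0 : 0 ≤ c) (hc1 : c ≤ 1)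
    (hG1 : ∀ p ∈ Pw, mwordEval 1 ((gw p).map Prod.fst) = G1 p)
    (hGc : ∀ p ∈ Pw, mwordEval c ((gw p).map Prod.fst) = Gc p) {β : ℝ} (hβ : 0 ≤ β) :
    β * ∑ p ∈ Pw, (1 - T.τ (Gc p) / T.N) - β * ∑ p ∈ Pw, (1 - T.τ (G1 p) / T.N) ≤
      (1 - c) * (β * ∑ p ∈ Pw, lw p * (dw p + 4 * sw p)) := by
  rw [← mul_sub, ← Finset.sum_sub_distrib]
  have hR : (1 - c) * (β * ∑ p ∈ Pw, lw p * (dw p + 4 * sw p)) =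
      β * ∑ p ∈ Pw, (1 - c) * (lw p * (dw p + 4 * sw p)) := by
    rw [Finset.mul_sum, Finset.mul_sum, Finset.mul_sum]
    refine Finset.sum_congr rfl fun p _ => ?_
    ring
  rw [hR]
  refine mul_le_mul_of_nonneg_left (Finset.sum_le_sum fun p hp => ?_) hβ
  have hs1 : sSum (gw p) ≤ 1 := (hsw p hp).trans (hsw1 p hp)
  have h := abs_trace_sub_le_moving T (hgood p hp) hs1 hc0 hc1
  rw [hG1 p hp, hGc p hp] at h
  obtain ⟨hs0, hl0⟩ := sSum_lSum_nonneg (hgood p hp)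
  have hd0 := ShellMeasureWilsonMoving.mdFro_nonneg ((gw p).map Prod.fst)
  have h1c : 0 ≤ 1 - c := by linarith
  have hle : T.τ (G1 p) - T.τ (Gc p) ≤ (1 - c) * T.N * lw p * (dw p + 4 * sw p) := by
    rw [← T.map_sub]
    refine (le_abs_self _).trans (h.trans ?_)
    have hf : 0 ≤ (1 - c) * T.N := mul_nonneg h1c hN.le
    have hm : lSum (gw p) * (mdFro ((gw p).map Prod.fst) + 4 * sSum (gw p)) ≤ lw p * (dw p + 4 * sw p) :=
      mul_le_mul (hlw p hp) (add_le_add (hdw p hp) (mul_le_mul_of_nonneg_left (hsw p hp) (by norm_num)))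
        (by positivity) (hl0.trans (hlw p hp))
    have := mul_le_mul_of_nonneg_left hm hf
    linarith [this]
  have e : 1 - T.τ (Gc p) / T.N - (1 - T.τ (G1 p) / T.N) = (T.τ (G1 p) - T.τ (Gc p)) / T.N := by
    field_simp; ring
  rw [e, div_le_iff₀ hN]
  calc T.τ (G1 p) - T.τ (Gc p) ≤ (1 - c) * T.N * lw p * (dw p + 4 * sw p) := hle
    _ = (1 - c) * (lw p * (dw p + 4 * sw p)) * T.N := by ring

/-- **(M1) AT ANY LEVEL FROM LEVEL DATA — THE ONE-DEPTH ASSEMBLY.**  See the module docstring for the reading of the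
binders.  DATA: trace datum `T` (`N > 0`); classifier plaquettes `P_u ≠ ∅` with continuous holonomies `hol p : E → A`;
weight plaquettes `P_w` with word functions `G p : E → A`; non-Wilson term `𝓔 : E → ℝ`; window `W` and factor `J`
(supported in `W`, centre-monotone); numbers `θ > 0`, `0 ≤ δ < 1`, `0 ≤ ρ ≤ (1−δ)/2`, `β ≥ 0`, `R > 1`, `H`, `B_𝓔`,
bounds `s̄ ≤ 1`, `L̄ ≥ 0`, `d̄ ≥ 0`.  ANALYTIC BINDERS, at every window point `x`: (AN-bound) for the classifier — per
`p ∈ P_u` an `f : ℂ → A` complex differentiable with `‖f‖ ≤ H` on `‖w‖ < R`, `f 0 = 0`, `f c = hol p (c•x) − 1` for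
`0 ≤ c ≤ 1`; GRADED SECTIONED WORDS for the weight — per `p ∈ P_w` a graded word (`MLetter.Good` letters, sizes,
Lipschitz constants) evaluating at every `c ∈ [0,1]` to `G p (c•x)`, with `s ≤ s̄_p`, `L ≤ L̄_p`, `d ≤ d̄_p`; the RAY
BOUND `𝓔(c•x) ≤ 𝓔(x) + (1−c)B_𝓔` for `1/2 ≤ c ≤ 1`; (SM) `36H/(R−1)² ≤ δθ`; finite sub-threshold mass.  CONCLUSION:
`SlotAntiConcentration (μ.withDensity (J·e^{−S})) u θ ρ (2·(dim E + β Σ_p L̄_p(d̄_p + 4s̄_p) + B_𝓔)/(1−δ))`. [folklore] -/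
theorem slotAntiConcentration_of_levelData (T : TraceData A) (hN : 0 < T.N)
    {ι κ : Type*} {Pu : Finset ι} (hPu : Pu.Nonempty) (hol : ι → E → A) (hcont : ∀ p ∈ Pu, Continuous (hol p))
    (Pw : Finset κ) (G : κ → E → A) (𝓔 : E → ℝ) {W : Set E} {J : E → ℝ≥0∞}
    {θ δ ρ β R H B𝓔 : ℝ} {sw lw dw : κ → ℝ}
    (hJW : ∀ x, J x ≠ 0 → x ∈ W) (hJ : ∀ x, ∀ a : ℝ, 0 ≤ a → J x ≤ J (Real.exp (-a) • x))
    -- (AN-bound) for the classifier plaquettes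
    (hR : 1 < R)
    (hAN : ∀ x ∈ W, ∀ p ∈ Pu, ∃ f : ℂ → A, DifferentiableOn ℂ f (ball 0 R) ∧ (∀ w ∈ ball (0 : ℂ) R, ‖f w‖ ≤ H) ∧
      f 0 = 0 ∧ ∀ c : ℝ, 0 ≤ c → c ≤ 1 → f (c : ℂ) = hol p (c • x) - 1)
    -- graded sectioned words for the weight plaquettes
    (hGW : ∀ x ∈ W, ∀ p ∈ Pw, ∃ gw : List (MLetter A × ℝ × ℝ), (∀ y ∈ gw, y.1.Good T.τ y.2.1 y.2.2) ∧
      sSum gw ≤ sw p ∧ lSum gw ≤ lw p ∧ mdFro (gw.map Prod.fst) ≤ dw p ∧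
      ∀ c : ℝ, 0 ≤ c → c ≤ 1 → mwordEval c (gw.map Prod.fst) = G p (c • x))
    (hsw1 : ∀ p ∈ Pw, sw p ≤ 1) (hsw0 : ∀ p ∈ Pw, 0 ≤ sw p) (hlw0 : ∀ p ∈ Pw, 0 ≤ lw p)
    (hdw0 : ∀ p ∈ Pw, 0 ≤ dw p)
    -- the non-Wilson ray bound
    (hE : ∀ x ∈ W, ∀ c : ℝ, 1 / 2 ≤ c → c ≤ 1 → 𝓔 (c • x) ≤ 𝓔 x + (1 - c) * B𝓔) (hB𝓔 : 0 ≤ B𝓔)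
    -- numbers
    (hθ : 0 < θ) (hδ0 : 0 ≤ δ) (hδ1 : δ < 1) (hρ0 : 0 ≤ ρ) (hρ : ρ ≤ (1 - δ) / 2) (hβ : 0 ≤ β)
    (hSM : 36 * H * 1 ^ 2 / (R - 1) ^ 2 ≤ δ * θ)
    (hfin : (μ.withDensity fun x => J x * weight T β Pw G 𝓔 x) {x | classifier hPu hol x < θ} ≠ ∞) :
    SlotAntiConcentration (μ.withDensity fun x => J x * weight T β Pw G 𝓔 x) (classifier hPu hol) θ ρ
      (2 * (Module.finrank ℝ E + (β * ∑ p ∈ Pw, lw p * (dw p + 4 * sw p) + B𝓔)) / (1 - δ)) := by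
  classical
  -- the depth
  have h1δ : 0 < 1 - δ := by linarith
  set ρ' := ρ / (1 - δ) with hρ'
  have hρ'0 : 0 ≤ ρ' := div_nonneg hρ0 h1δ.le
  have hρ'2 : ρ' ≤ 1 / 2 := by rw [hρ', div_le_iff₀ h1δ]; linarith
  set a := -Real.log (1 - ρ') with ha
  have hc0 : 0 < 1 - ρ' := by linarith
  have hc1 : 1 - ρ' ≤ 1 := by linarith
  have hchalf : 1 / 2 ≤ 1 - ρ' := by linarith
  have hexp : Real.exp (-a) = 1 - ρ' := by rw [ha, neg_neg, Real.exp_log hc0]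
  have ha0 : 0 ≤ a := by rw [ha, neg_nonneg]; exact Real.log_nonpos hc0.le hc1
  have ha2 : a ≤ 2 * ρ' := T4ShellMeasureFibre.neg_log_one_sub_le hρ'0 hρ'2
  have h1ca : 1 - (1 - ρ') ≤ a := by
    have h := Real.log_le_sub_one_of_pos hc0
    rw [ha]; linarith
  have hρlt : ρ < 1 - δ := by linarith
  set Bf := β * ∑ p ∈ Pw, lw p * (dw p + 4 * sw p) + B𝓔 with hBf
  have hBf0 : 0 ≤ Bf := by
    rw [hBf]
    refine add_nonneg (mul_nonneg hβ (Finset.sum_nonneg fun p hp => ?_)) hB𝓔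
    exact mul_nonneg (hlw0 p hp) (add_nonneg (hdw0 p hp) (mul_nonneg (by norm_num) (hsw0 p hp)))
  have hu : Measurable (classifier hPu hol) := (continuous_classifier hPu hcont).measurable
  refine slotAntiConcentration_of_coreMap_mul μ hu (a := a) (Bf := Bf) hθ.le hρ0 hfin (fun x => hJ x a ha0)
    ?_ ?_ ?_
  · -- (S-i): the core map from (AN-bound) + (SM), all plaquettes alike
    intro x hx hJx _
    have hxW : x ∈ W := hJW x hJx
    rw [hexp]
    choose f hf using hAN x hxW
    have key := coreMap_of_analytic_family hPu (f := fun p => if hp : p ∈ Pu then f p hp else 0)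
      (R := R) (H := H) (x₀ := 1) (θ := θ) (δ := δ) (ρ := ρ) one_pos hR
      (fun p hp => by simp only [dif_pos hp]; exact (hf p hp).1)
      (fun p hp => by simp only [dif_pos hp]; exact (hf p hp).2.1)
      (fun p hp => by simp only [dif_pos hp]; exact (hf p hp).2.2.1)
      (z₀ := 1) ⟨one_pos, le_rfl⟩ hθ hδ0 hδ1 hρ0 hρlt hSM ?_
    · -- read the conclusion back on `hol`
      have hrw : classifier hPu hol ((1 - ρ') • x) =
          Pu.sup' hPu fun p => ‖(if hp : p ∈ Pu then f p hp else 0) ((((1 - ρ / (1 - δ)) * 1 : ℝ)) : ℂ)‖ := by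
        unfold classifier
        refine Finset.sup'_congr hPu rfl fun p hp => ?_
        simp only [dif_pos hp, mul_one]
        rw [(hf p hp).2.2.2 (1 - ρ') hc0.le hc1]
      rw [hrw]; exact key
    · -- the hypothesis at `c = 1`
      have hrw : (Pu.sup' hPu fun p => ‖(if hp : p ∈ Pu then f p hp else 0) ((1 : ℝ) : ℂ)‖) =
          classifier hPu hol x := by
        unfold classifier
        refine Finset.sup'_congr hPu rfl fun p hp => ?_
        simp only [dif_pos hp]
        rw [(hf p hp).2.2.2 1 zero_le_one le_rfl, one_smul]
      rw [hrw]; exact hx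
  · -- (S-ii): Wilson part from the graded words + the non-Wilson ray bound
    intro x hx hJx _
    have hxW : x ∈ W := hJW x hJx
    rw [hexp]
    unfold weight action
    choose gw hgw using hGW x hxW
    have hW := wilsonPart_contract_sub_le T hN Pw (fun p => G p ((1 - ρ') • x)) (fun p => G p x)
      (fun p => if hp : p ∈ Pw then gw p hp else [])
      (fun p hp => by simp only [dif_pos hp]; exact (hgw p hp).1)
      (sw := sw) (lw := lw) (dw := dw)
      (fun p hp => by simp only [dif_pos hp]; exact (hgw p hp).2.1) hsw1
      (fun p hp => by simp only [dif_pos hp]; exact (hgw p hp).2.2.1)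
      (fun p hp => by simp only [dif_pos hp]; exact (hgw p hp).2.2.2.1) hc0.le hc1
      (fun p hp => by simp only [dif_pos hp]; rw [(hgw p hp).2.2.2.2 1 zero_le_one le_rfl, one_smul])
      (fun p hp => by simp only [dif_pos hp]; exact (hgw p hp).2.2.2.2 (1 - ρ') hc0.le hc1) hβ
    have hEx := hE x hxW (1 - ρ') hchalf hc1
    have hle : β * ∑ p ∈ Pw, (1 - T.τ (G p ((1 - ρ') • x)) / T.N) + 𝓔 ((1 - ρ') • x) -
        (β * ∑ p ∈ Pw, (1 - T.τ (G p x) / T.N) + 𝓔 x) ≤ Bf * a := by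
      have h1 : (1 - (1 - ρ')) * (β * ∑ p ∈ Pw, lw p * (dw p + 4 * sw p)) + (1 - (1 - ρ')) * B𝓔 ≤ Bf * a := by
        rw [← mul_add, ← hBf, mul_comm]
        exact mul_le_mul_of_nonneg_left h1ca hBf0
      linarith
    rw [← ENNReal.ofReal_mul (Real.exp_pos _).le, ← Real.exp_add]
    exact ENNReal.ofReal_le_ofReal (Real.exp_le_exp.2 (by linarith))
  · -- the constant
    have hn : (0 : ℝ) ≤ Module.finrank ℝ E + Bf := by positivity
    calc (Module.finrank ℝ E + Bf) * a ≤ (Module.finrank ℝ E + Bf) * (2 * ρ') := mul_le_mul_of_nonneg_left ha2 hn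
      _ = 2 * (Module.finrank ℝ E + Bf) / (1 - δ) * ρ := by rw [hρ']; field_simp


/-! ## Bond-level wiring of the classifier binder (AN-bound) through the lineage's plaquette importer -/

section BondWiring

variable {A : Type*} [NormedRing A] [NormedAlgebra ℂ A] [CompleteSpace A]

open T4ShellMeasurePlaquette (plaquetteFn differentiableOn_plaquetteFn plaquetteFn_apply_zero plaquetteFn_eq)
open ShellMeasureWilsonWords (normSum wordExp norm_wordExp_sub_one_le)

omit [NormedAlgebra ℂ A] [CompleteSpace A] in
/-- bookkeeping: a uniform bond bound `‖X_i z‖ ≤ a` gives `normSum ≤ length · a`. [folklore] -/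
theorem normSum_map_le {Xs : List (ℂ → A)} {z : ℂ} {a : ℝ} (ha : ∀ X ∈ Xs, ‖X z‖ ≤ a) :
    normSum (Xs.map fun X => X z) ≤ Xs.length * a := by
  induction Xs with
  | nil => simp [normSum]
  | cons X Xs ih =>
    have h1 := ha X (by simp)
    have h2 := ih fun Y hY => ha Y (List.mem_cons_of_mem _ hY)
    simp only [List.map_cons, ShellMeasureWilsonWords.normSum_cons, List.length_cons, Nat.cast_succ]
    linarith

/-- **(AN-bound) FOR A PLAQUETTE FROM BOND DATA OF B11 PROP. 9's PRINTED TYPE.**  If the oriented bond variables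
`X₁, …, X_ℓ : ℂ → A` of `∂p` along the complexified contraction ray are complex differentiable on `‖w‖ < R` with
`‖X_i‖ ≤ a` there and `X_i 0 = 0` (flat centre), and the holonomy along the real ray is their word of exponentials,
then the plaquette functional `f = plaquetteFn Xs` is the witness asked by the binder `hAN` of
`slotAntiConcentration_of_levelData`: complex differentiable, bounded by `H = e^{ℓa} − 1`, `f 0 = 0`, and
`f c = hol(c) − 1` on `[0,1]`.  (The bond data are the located (AN-bound) — NOT instantiated.) [folklore] -/
theorem classifierWitness_of_bondData {Xs : List (ℂ → A)} {R a : ℝ} {hol : ℝ → A}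
    (hX : ∀ X ∈ Xs, DifferentiableOn ℂ X (ball 0 R)) (ha : ∀ X ∈ Xs, ∀ w ∈ ball (0 : ℂ) R, ‖X w‖ ≤ a)
    (h0 : ∀ X ∈ Xs, X 0 = 0)
    (hhol : ∀ c : ℝ, 0 ≤ c → c ≤ 1 → hol c = wordExp (Xs.map fun X => X (c : ℂ))) :
    ∃ f : ℂ → A, DifferentiableOn ℂ f (ball 0 R) ∧
      (∀ w ∈ ball (0 : ℂ) R, ‖f w‖ ≤ Real.exp (Xs.length * a) - 1) ∧ f 0 = 0 ∧
      ∀ c : ℝ, 0 ≤ c → c ≤ 1 → f (c : ℂ) = hol c - 1 := by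
  refine ⟨plaquetteFn Xs, differentiableOn_plaquetteFn hX, fun w hw => ?_, plaquetteFn_apply_zero h0, fun c hc0 hc1 => ?_⟩
  · rw [plaquetteFn_eq]
    have h := norm_wordExp_sub_one_le (Xs.map fun X => X w)
    have hs := normSum_map_le (z := w) fun X hX' => ha X hX' w hw
    unfold wordExp at h
    exact h.trans (by gcongr)
  · rw [hhol c hc0 hc1, plaquetteFn_eq]; rfl

/-- **THE WEIGHT-SIDE LETTER FROM BOND DATA OF B11 PROP. 9's PRINTED TYPE.**  A bond variable `𝓧 : ℂ → A` complex
differentiable with `‖𝓧‖ ≤ a` on `‖w‖ < R` (`R > 1`), `τ`-free with contracting exponentials on the real segment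
`[0,1]` (skew-Hermitian values — NOT instantiated), read along the contraction ray of the point (`z₀ = x₀ = 1`), is an
admissible MOVING letter with size `a` and Lipschitz constant `3a/(R − 1)` (`movingData_of_differentiableOn_ball`) —
the datum asked by the binder `hGW` of `slotAntiConcentration_of_levelData`. [folklore] -/
theorem good_moving_of_bondData (T : TraceData A) {𝓧 : ℂ → A} {R a : ℝ} (hR : 1 < R)
    (hX : DifferentiableOn ℂ 𝓧 (ball 0 R)) (ha : ∀ w ∈ ball (0 : ℂ) R, ‖𝓧 w‖ ≤ a)
    (hτ : ∀ c : ℝ, 0 ≤ c → c ≤ 1 → T.τ (𝓧 c) = 0) (hU : ∀ c : ℝ, 0 ≤ c → c ≤ 1 → ‖exp (𝓧 c)‖ ≤ 1) :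
    (MLetter.moving fun c : ℝ => 𝓧 c).Good T.τ a (3 * a / (R - 1) * 1) := by
  have ha0 : 0 ≤ a := (norm_nonneg _).trans (ha 0 (mem_ball_self (one_pos.trans hR)))
  refine ⟨ha0, by rw [mul_one]; exact div_nonneg (by positivity) (by linarith), fun c hc0 hc1 => ?_⟩
  have hmd := ShellMeasureWilsonMoving.movingData_of_differentiableOn_ball (z₀ := 1) one_pos hR hX ha
    ⟨one_pos, le_rfl⟩ hc0 hc1
  simp only [mul_one] at hmd ⊢
  exact ⟨hτ c hc0 hc1, hU c hc0 hc1, hmd.1, by simpa only [Complex.ofReal_one] using hmd.2⟩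

end BondWiring

end Summit.QuantumFields.BalabanUV.T4Continuum.ShellMeasureLevelAssembly
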